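import Mathlib

/-!
# PercRepro — the `(7,3)` cell: THE LINE TABLE of Theorem P₁(7,3) (p3, gen 15)

mine-2's `MINE2-RLS.md` §27.1–27.3: in the reduced world of a `3`-point flat `T` (rank `7`, `E = T ⊔ W`, `|W| = 7`),
the witnesses of nullity one are grouped by the line `λ` of the dual through `W ∖ X`; the contribution of a line,
`Δ_λ = Σ_Z C(c₁,z₁)⋯C(ℓ₀,z_ℓ)·[1/D_line(a, x) − g(x)·[x ≤ 3]]`, depends only on its LINE DATUM: `k = |T ∩ λ| ≤ 2`, the number
`ℓ₀ ≤ 3` of loops of the dual (coloops of the world), and the sizes `c₁ ≥ c₂ ≥ … ` of the parallel classes of `W`-points on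
`λ` (`L = Σ cᵢ`, `L + ℓ₀ ≤ 5` by the flat condition). Here `Z` runs over the choices of `zᵢ ≤ cᵢ` points of the classes
(meeting at least two classes) and `z_ℓ ≤ ℓ₀` loops with `z = Σ zᵢ + z_ℓ ≥ 3`, `x = 7 − z`, `a = k + (L − Σ zᵢ) + (ℓ₀ − z_ℓ)`,
`D_line(a, x) = C(x+3, 3) − C(a, x) + (6 − m)·C(a, x − 1)` with `m = 3 + x − a` (Lemma 24.1) and `g(x) = 1/C(x+3, 3)`.

This file is the table in INTEGER FORM: every denominator `D_line(a, x)` with `a ≤ 7`, `1 ≤ x ≤ 4` and every `C(x+3, 3)`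
with `x ≤ 3` divides `Lc = 448 204 680`, and `deltaN k ℓ₀ cs = Lc · Δ_λ` is computed by a structural recursion over the
class list. THEOREM `lineTable`: for every `k ≤ 2`, `ℓ₀ ≤ 3` and every sorted class vector `c₁ ≥ … ≥ c₅ ≥ 0` with
`Σ cᵢ + ℓ₀ ≤ 5`, `deltaN ≥ 0` when `ℓ₀ ≤ 2` and `deltaN ≥ −4 918 188 = −(53/4830)·Lc` when `ℓ₀ = 3` — the eight minima
of §27.3 (`1/35`, `1/35`, `44/2415`, `−53/4830` and the trivial `0`s) in the kernel, by `decide +kernel` on the 126 cells.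
Second implementation: `mining/p3/g15/linetable_twin.py` (the same recursion in python: `= Lc·Δ_λ` on all 317 data of the
prose enumeration, 0 mismatches). (`P3-C025-seven-three-plan.md` §6, M6 — the line half.)
-/

namespace PercRepro

namespace SevenThree

namespace LineTable

/-- The common denominator of the line table: `lcm` of `D_line(a, x)` over `a ≤ 7`, `1 ≤ x ≤ 4`, and of `C(x+3,3)`, `x ≤ 3`. -/
def Lc : ℤ := 448204680

/-- Lemma 24.1's denominator `D_line(a, x) = C(x+3,3) − C(a,x) + (6 − (3 + x − a))·C(a, x−1)`, as an integer. -/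
def DlineN (a x : ℕ) : ℤ :=
  (Nat.choose (x + 3) 3 : ℤ) - (Nat.choose a x : ℤ) + (6 - (3 + (x : ℤ) - (a : ℤ))) * (Nat.choose a (x - 1) : ℤ)

/-- The `Φ`-term `Lc·g(x) = Lc / C(x+3, 3)` for `x ≤ 3`, and `0` for `x ≥ 4`. -/
def phiTermN (x : ℕ) : ℤ := if x ≤ 3 then Lc / (Nat.choose (x + 3) 3 : ℤ) else 0

/-- The scaled bracket `Lc·[1/D_line(a, x) − g(x)·[x ≤ 3]]` of a witness class: `sz` points chosen from the classes
(`hit` classes met), `zl` loops; `0` unless at least two classes are met and `z = sz + zl ≥ 3`. -/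
def bracketN (k l0 L sz zl hit : ℕ) : ℤ :=
  if hit < 2 ∨ sz + zl < 3 then 0
  else Lc / DlineN (k + (L - sz) + (l0 - zl)) (7 - (sz + zl)) - phiTermN (7 - (sz + zl))

/-- `Σ_{i ≤ n} f i`, structurally. -/
def sumTo : ℕ → (ℕ → ℤ) → ℤ
  | 0, f => f 0
  | n + 1, f => sumTo n f + f (n + 1)

/-- The sum over the loop choices `zl ≤ l0`, weighted by `C(l0, zl)` and the class multiplicity `mult`. -/
def loopSum (k l0 L sz hit : ℕ) (mult : ℤ) : ℤ :=
  sumTo l0 (fun zl => (Nat.choose l0 zl : ℤ) * mult * bracketN k l0 L sz zl hit)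

/-- The sum over the choices `z ≤ c` from each class `c` of the list, accumulating `sz`, `hit` and the multiplicity. -/
def classSum (k l0 L : ℕ) : List ℕ → ℕ → ℕ → ℤ → ℤ
  | [], sz, hit, mult => loopSum k l0 L sz hit mult
  | c :: cs, sz, hit, mult =>
      sumTo c (fun z => classSum k l0 L cs (sz + z) (hit + (if z = 0 then 0 else 1)) (mult * (Nat.choose c z : ℤ)))

/-- `Lc · Δ_λ` for the line datum `(k, l0, cs)`. -/
def deltaN (k l0 : ℕ) (cs : List ℕ) : ℤ := classSum k l0 cs.sum cs 0 0 1

/-- The lower bound of the table: `0` at `ℓ₀ ≤ 2`, `−(53/4830)·Lc` at `ℓ₀ = 3`. -/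
def lineBound (l0 : ℕ) : ℤ := if l0 ≤ 2 then 0 else -4918188

/-- The table at fixed `(k, ℓ₀)`: every sorted class vector `c₁ ≥ … ≥ c₅` with `Σ cᵢ + ℓ₀ ≤ 5` has `deltaN ≥ lineBound ℓ₀`. -/
def LineCheck (k l0 : ℕ) : Prop :=
  ∀ c1 < 6, ∀ c2 < c1 + 1, ∀ c3 < c2 + 1, ∀ c4 < c3 + 1, ∀ c5 < c4 + 1,
    (!decide (c1 + c2 + c3 + c4 + c5 + l0 ≤ 5) || decide (lineBound l0 ≤ deltaN k l0 [c1, c2, c3, c4, c5])) = true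

/-- `LineCheck` is decidable. -/
instance (k l0 : ℕ) : Decidable (LineCheck k l0) := by unfold LineCheck; infer_instance

/-- `LineCheck 0 0` (by `decide +kernel`). -/
theorem lineCheck_0_0 : LineCheck 0 0 := by unfold LineCheck; decide +kernel
/-- `LineCheck 0 1`. -/
theorem lineCheck_0_1 : LineCheck 0 1 := by unfold LineCheck; decide +kernel
/-- `LineCheck 0 2`. -/
theorem lineCheck_0_2 : LineCheck 0 2 := by unfold LineCheck; decide +kernel
/-- `LineCheck 0 3`. -/
theorem lineCheck_0_3 : LineCheck 0 3 := by unfold LineCheck; decide +kernel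
/-- `LineCheck 1 0`. -/
theorem lineCheck_1_0 : LineCheck 1 0 := by unfold LineCheck; decide +kernel
/-- `LineCheck 1 1`. -/
theorem lineCheck_1_1 : LineCheck 1 1 := by unfold LineCheck; decide +kernel
/-- `LineCheck 1 2`. -/
theorem lineCheck_1_2 : LineCheck 1 2 := by unfold LineCheck; decide +kernel
/-- `LineCheck 1 3`. -/
theorem lineCheck_1_3 : LineCheck 1 3 := by unfold LineCheck; decide +kernel
/-- `LineCheck 2 0`. -/
theorem lineCheck_2_0 : LineCheck 2 0 := by unfold LineCheck; decide +kernel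
/-- `LineCheck 2 1`. -/
theorem lineCheck_2_1 : LineCheck 2 1 := by unfold LineCheck; decide +kernel
/-- `LineCheck 2 2`. -/
theorem lineCheck_2_2 : LineCheck 2 2 := by unfold LineCheck; decide +kernel
/-- `LineCheck 2 3` — the one cell with negative data (`k = 2`, two singleton classes, three loops: `−4918188`). -/
theorem lineCheck_2_3 : LineCheck 2 3 := by unfold LineCheck; decide +kernel

/-- **THE LINE TABLE**: for every `k ≤ 2` and `ℓ₀ ≤ 3`, `LineCheck k ℓ₀`. -/
theorem lineTable : ∀ k < 3, ∀ l0 < 4, LineCheck k l0 := by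
  intro k hk l0 hl0
  interval_cases k <;> interval_cases l0
  · exact lineCheck_0_0
  · exact lineCheck_0_1
  · exact lineCheck_0_2
  · exact lineCheck_0_3
  · exact lineCheck_1_0
  · exact lineCheck_1_1
  · exact lineCheck_1_2
  · exact lineCheck_1_3
  · exact lineCheck_2_0
  · exact lineCheck_2_1
  · exact lineCheck_2_2
  · exact lineCheck_2_3

/-- The table as a statement about a datum: a sorted class vector with `Σ cᵢ + ℓ₀ ≤ 5` has `deltaN ≥ lineBound ℓ₀`. -/
theorem deltaN_ge_of_datum {k l0 c1 c2 c3 c4 c5 : ℕ} (hk : k < 3) (hl0 : l0 < 4) (h21 : c2 ≤ c1) (h32 : c3 ≤ c2)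
    (h43 : c4 ≤ c3) (h54 : c5 ≤ c4) (hsum : c1 + c2 + c3 + c4 + c5 + l0 ≤ 5) :
    lineBound l0 ≤ deltaN k l0 [c1, c2, c3, c4, c5] := by
  have h1 : c1 < 6 := by omega
  have hc := lineTable k hk l0 hl0 c1 h1 c2 (by omega) c3 (by omega) c4 (by omega) c5 (by omega)
  rw [Bool.or_eq_true, Bool.not_eq_true', decide_eq_false_iff_not, decide_eq_true_eq] at hc
  rcases hc with hc | hc
  · exact absurd hsum hc
  · exact hc

/-- Every denominator of the box divides `Lc` (so `Lc / D_line(a, x)` is exact on every cell): `a ≤ 7`, `1 ≤ x ≤ 4`. -/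
theorem dvd_Lc_of_box : ∀ a < 8, ∀ x < 5, (!decide (1 ≤ x) || decide (DlineN a x ∣ Lc)) = true := by
  decide +kernel

/-- `C(x+3, 3)` divides `Lc` for `x ≤ 3`. -/
theorem choose_dvd_Lc : ∀ x < 4, (Nat.choose (x + 3) 3 : ℤ) ∣ Lc := by decide +kernel

/-- Every denominator of the box is positive. -/
theorem DlineN_pos_of_box : ∀ a < 8, ∀ x < 5, (!decide (1 ≤ x) || decide (0 < DlineN a x)) = true := by
  decide +kernel

end LineTable

end SevenThree

end PercRepro
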